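import Mathlib
import Literature.NumberTheory.Automorphic.ResGLnConeDictionaryCone
import HarnessLib

/-!
# Invariances of the lift of an equivariant basic family of cone forms —
crux `HeckeEigenvalueField` (stmt-Langlands-13632), line `Sketch`, stub LIFT-INV

Namespace `Summit.Langlands.Langlands.Theorems.HeckeEigenvalueField.Res`.  Theorems only.
Let `G_∞ = GL_n(K_∞)` (`(AutomorphyDatum.gl n K hcpt).arch`), `X = ResGLnCone.hermSpace n K`,
`sq h = h hᴴ ∈ X` the hermitian square and `tg h Y = h Y hᴴ + h Yᴴ hᴴ` its differential on the
left-invariant field of `Y ∈ 𝔤𝔩_n(K_∞)` (both given abstractly through `hsq`, `htg`).  For a family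
`β_c` of `E`-valued `q`-forms on `X` indexed by the cosets `c` of the level `K_f(𝔫)` which is
EQUIVARIANT under `GL_n(K)` with the sign-twisted archimedean coefficient action `σS` (`hβeq`) and BASIC
(`hβsc`: invariant under the dilations `H ↦ r H`; `hβeu`: killed by the Euler vector `H` at `H`), the lift
`u(Y)(g, c) = σS(g)⁻¹ β_c(g gᴴ)(tg_g Y₁, …, tg_g Y_q)` is left `GL_n(K)`-invariant, homogeneous under the
split centre `exp(t · 1)`, right `K_f(𝔫)`-invariant, and vanishes if some `Yᵢ` is skew-hermitian or the
centre `1`.  Elementary matrix algebra: `sq (γ g) = γ · sq g`, `tg (γ g) Y = γ · tg g Y`;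
`exp(t · 1) = e^t · 1` (`coe_expMem_smul_one`) so `sq`, `tg` scale by `e^{2t}` and
`σS(exp(-t · 1)) = e^{-tw}`; `tg g Y = 0` for skew `Y`; `tg g 1 = 2 sq g`.
Reference: A. Borel, N. Wallach, *Continuous cohomology, discrete subgroups, and representations of
reductive groups*, 2nd ed. (2000), VII 2.2–2.5. [BorelWallach2000]
-/

set_option linter.dupNamespace false -- project-wide: `Summit.Langlands.Langlands` is the mandated namespace

noncomputable section

open scoped Classical Matrix
open NumberField NumberField.mixedEmbedding Literature.NumberTheory.Automorphic

namespace Summit.Langlands.Langlands.Theorems.HeckeEigenvalueField.Res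

set_option maxHeartbeats 800000 in
-- five conjuncts over the datum-typed `σS` / `expMem` towers in one declaration (≈ 100k heartbeats each)
/-- **Stub LIFT-INV — invariances of the lift.**  For a family `β_c` of `q`-forms on the cone indexed by
the finite-adelic group (constant on cosets of the level `K_f(𝔫)`), equivariant under the full rational
group with the sign-twisted archimedean coefficient action (as the cone form is, EQUIV-FULL) and BASIC
(scale-invariant, killed by the Euler field), its lift `u(Y)(g, c) = σS(g)⁻¹ β_c(g gᴴ)(tg_g Y₁, …, tg_g Y_q)`
(`tg_g Y = g (Y + Yᴴ) gᴴ`, the hermitian square `sq` and `tg` given abstractly as in LIFT-D) is: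
left-invariant under `GL_n(K)` (`(γ_∞ g, γ_f c)`), homogeneous of degree `-w` under the split component
`exp(tZ)` (`σS(e^t) = e^{tw}`, `sq(e^t g) = e^{2t} sq g`, `tg` likewise, basic `β`), right-invariant under
the level, and it vanishes when some `Yᵢ` is skew-hermitian (`tg_g Y = 0`) or is the centre `Z`
(`tg_g Z = 2 sq g`, Euler). [cite: BorelWallach2000, VII 2.2–2.5] -/
theorem stub_lift_invariances {n : ℕ} {K : Type} [Field K] [NumberField K]
    (hcpt : isCompact_glFiniteIntegralLevel n K) (𝔫 : Ideal (𝓞 K))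
    (S : Finset {w : InfinitePlace K // w.IsReal}) (lam : (K →+* ℂ) → Fin n → ℤ) {q : ℕ}
    (sq : (AutomorphyDatum.gl n K hcpt).arch.carrier → ResGLnCone.hermSpace n K)
    (hsq : ∀ h : (AutomorphyDatum.gl n K hcpt).arch.carrier,
      (sq h : Matrix (Fin n) (Fin n) (mixedSpace K)) =
        ((h : GL (Fin n) (mixedSpace K)) : Matrix (Fin n) (Fin n) (mixedSpace K)) *
          (((h : GL (Fin n) (mixedSpace K)) : Matrix (Fin n) (Fin n) (mixedSpace K)))ᴴ)
    (tg : (AutomorphyDatum.gl n K hcpt).arch.carrier → (AutomorphyDatum.gl n K hcpt).arch.lie →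
      ResGLnCone.hermSpace n K)
    (htg : ∀ (h : (AutomorphyDatum.gl n K hcpt).arch.carrier) (Y : (AutomorphyDatum.gl n K hcpt).arch.lie),
      (tg h Y : Matrix (Fin n) (Fin n) (mixedSpace K)) =
        ((h : GL (Fin n) (mixedSpace K)) : Matrix (Fin n) (Fin n) (mixedSpace K)) *
            (Y : Matrix (Fin n) (Fin n) (mixedSpace K)) *
            (((h : GL (Fin n) (mixedSpace K)) : Matrix (Fin n) (Fin n) (mixedSpace K)))ᴴ +
          ((h : GL (Fin n) (mixedSpace K)) : Matrix (Fin n) (Fin n) (mixedSpace K)) *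
            (Y : Matrix (Fin n) (Fin n) (mixedSpace K))ᴴ *
            (((h : GL (Fin n) (mixedSpace K)) : Matrix (Fin n) (Fin n) (mixedSpace K)))ᴴ)
    (β : (BigHeckeGLn.FiniteAdelicGL n K ⧸ ResGLnCohomology.level n K 𝔫) →
      ResGLnCone.hermSpace n K → ResGLnCone.hermSpace n K [⋀^Fin q]→L[ℝ] ResGLnCohomology.CoeffModule ℂ n K lam)
    (hβeq : ∀ (γ : GL (Fin n) K) (c : BigHeckeGLn.FiniteAdelicGL n K ⧸ ResGLnCohomology.level n K 𝔫)
      (H : ResGLnCone.hermSpace n K), H ∈ ResGLnCone.posCone n K → ∀ v : Fin q → ResGLnCone.hermSpace n K,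
      β (BigHeckeGLn.globalEmbedding n K γ • c) (ResGLnCone.coneActionRat n K γ H)
          (fun i => ResGLnCone.coneActionRat n K γ (v i)) =
        ConeDictionary.σS hcpt S lam (ParallelWeight.diagArch K n γ) (β c H v))
    (hβsc : ∀ (c : BigHeckeGLn.FiniteAdelicGL n K ⧸ ResGLnCohomology.level n K 𝔫) (r : ℝ), 0 < r →
      ∀ H ∈ ResGLnCone.posCone n K, ∀ v : Fin q → ResGLnCone.hermSpace n K,
        β c (r • H) (fun i => r • v i) = β c H v)
    (hβeu : ∀ (c : BigHeckeGLn.FiniteAdelicGL n K ⧸ ResGLnCohomology.level n K 𝔫),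
      ∀ H ∈ ResGLnCone.posCone n K, ∀ v : Fin q → ResGLnCone.hermSpace n K, (∃ i, v i = H) → β c H v = 0)
    {w : ℝ} (hσZ : ∀ (t : ℝ) (v : ResGLnCohomology.CoeffModule ℂ n K lam),
      ConeDictionary.σS hcpt S lam ((AutomorphyDatum.gl n K hcpt).arch.expMem
        (t • (⟨1, trivial⟩ : (AutomorphyDatum.gl n K hcpt).arch.lie))) v = (Real.exp (t * w) : ℂ) • v)
    (u : (Fin q → (AutomorphyDatum.gl n K hcpt).arch.lie) → (AutomorphyDatum.gl n K hcpt).arch.carrier →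
      BigHeckeGLn.FiniteAdelicGL n K → ResGLnCohomology.CoeffModule ℂ n K lam)
    (hu : ∀ Yt g c, u Yt g c = ConeDictionary.σS hcpt S lam g⁻¹
      (β (c : BigHeckeGLn.FiniteAdelicGL n K ⧸ ResGLnCohomology.level n K 𝔫) (sq g) (fun i => tg g (Yt i)))) :
    (∀ (γ : GL (Fin n) K) (Yt : Fin q → (AutomorphyDatum.gl n K hcpt).arch.lie)
        (g : (AutomorphyDatum.gl n K hcpt).arch.carrier) (c : BigHeckeGLn.FiniteAdelicGL n K),
        u Yt ((show (AutomorphyDatum.gl n K hcpt).arch.carrier from ParallelWeight.diagArch K n γ) * g)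
          (BigHeckeGLn.globalEmbedding n K γ * c) = u Yt g c) ∧
    (∀ (t : ℝ) (Yt : Fin q → (AutomorphyDatum.gl n K hcpt).arch.lie)
        (g : (AutomorphyDatum.gl n K hcpt).arch.carrier) (c : BigHeckeGLn.FiniteAdelicGL n K),
        u Yt (g * (AutomorphyDatum.gl n K hcpt).arch.expMem
            (t • (⟨1, trivial⟩ : (AutomorphyDatum.gl n K hcpt).arch.lie))) c =
          (Real.exp (-(t * w)) : ℂ) • u Yt g c) ∧
    (∀ (Yt : Fin q → (AutomorphyDatum.gl n K hcpt).arch.lie) (g : (AutomorphyDatum.gl n K hcpt).arch.carrier)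
        (c : BigHeckeGLn.FiniteAdelicGL n K), ∀ v ∈ ResGLnCohomology.level n K 𝔫, u Yt g (c * v) = u Yt g c) ∧
    (∀ (Yt : Fin q → (AutomorphyDatum.gl n K hcpt).arch.lie) (g : (AutomorphyDatum.gl n K hcpt).arch.carrier)
        (c : BigHeckeGLn.FiniteAdelicGL n K),
        (∃ i, ((Yt i : (AutomorphyDatum.gl n K hcpt).arch.lie) : Matrix (Fin n) (Fin n) (mixedSpace K))ᴴ =
          -((Yt i : (AutomorphyDatum.gl n K hcpt).arch.lie) : Matrix (Fin n) (Fin n) (mixedSpace K))) →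
        u Yt g c = 0) ∧
    ∀ (Yt : Fin q → (AutomorphyDatum.gl n K hcpt).arch.lie) (g : (AutomorphyDatum.gl n K hcpt).arch.carrier)
        (c : BigHeckeGLn.FiniteAdelicGL n K),
        (∃ i, Yt i = (⟨1, trivial⟩ : (AutomorphyDatum.gl n K hcpt).arch.lie)) → u Yt g c = 0 := by
  -- (0) the hermitian square of an invertible matrix lies in the positive cone: `sq g = g · 1`
  have hpos : ∀ g : (AutomorphyDatum.gl n K hcpt).arch.carrier, sq g ∈ ResGLnCone.posCone n K := by
    intro g
    have h : sq g = ResGLnCone.coneAction n K (g : GL (Fin n) (mixedSpace K)) (ResGLnCone.hermOne n K) :=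
      Subtype.ext (by rw [hsq, ResGLnCone.coe_coneAction, ResGLnCone.coe_hermOne, Matrix.mul_one])
    rw [h]
    exact ResGLnCone.mapsTo_coneAction_posCone n K _ (ResGLnCone.hermOne_mem_posCone n K)
  refine ⟨?_, ?_, ?_, ?_, ?_⟩
  · -- (1) left invariance under `GL_n(K)`: `sq (γ̃ g) = γ · sq g`, `tg (γ̃ g) Y = γ · tg g Y`, `hβeq`
    intro γ Yt g c
    set d : (AutomorphyDatum.gl n K hcpt).arch.carrier :=
      (show (AutomorphyDatum.gl n K hcpt).arch.carrier from ParallelWeight.diagArch K n γ)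
    have heq : ∀ (c' : BigHeckeGLn.FiniteAdelicGL n K ⧸ ResGLnCohomology.level n K 𝔫) (H : ResGLnCone.hermSpace n K),
        H ∈ ResGLnCone.posCone n K → ∀ v : Fin q → ResGLnCone.hermSpace n K,
        β (BigHeckeGLn.globalEmbedding n K γ • c') (ResGLnCone.coneActionRat n K γ H)
            (fun i => ResGLnCone.coneActionRat n K γ (v i)) = ConeDictionary.σS hcpt S lam d (β c' H v) :=
      hβeq γ
    have hdU : ((d : (AutomorphyDatum.gl n K hcpt).arch.carrier) : GL (Fin n) (mixedSpace K)) =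
        ResGLnCone.toMixedGL n K γ := rfl
    have hsqd : sq (d * g) = ResGLnCone.coneActionRat n K γ (sq g) := Subtype.ext (by
      rw [hsq, ResGLnCone.coneActionRat_apply, ResGLnCone.coe_coneAction, hsq, Subgroup.coe_mul, Units.val_mul,
        hdU, Matrix.conjTranspose_mul]
      simp only [Matrix.mul_assoc])
    have htgd : ∀ Y, tg (d * g) Y = ResGLnCone.coneActionRat n K γ (tg g Y) := fun Y => Subtype.ext (by
      rw [htg, ResGLnCone.coneActionRat_apply, ResGLnCone.coe_coneAction, htg, Subgroup.coe_mul, Units.val_mul,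
        hdU, Matrix.conjTranspose_mul]
      simp only [Matrix.mul_add, Matrix.add_mul, Matrix.mul_assoc])
    have hc : ((BigHeckeGLn.globalEmbedding n K γ * c : BigHeckeGLn.FiniteAdelicGL n K) :
        BigHeckeGLn.FiniteAdelicGL n K ⧸ ResGLnCohomology.level n K 𝔫) =
        BigHeckeGLn.globalEmbedding n K γ • (c : BigHeckeGLn.FiniteAdelicGL n K ⧸ ResGLnCohomology.level n K 𝔫) :=
      rfl
    rw [hu, hu, hsqd, hc]
    simp only [htgd]
    rw [heq _ (sq g) (hpos g), mul_inv_rev, map_mul, Module.End.mul_apply]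
    congr 1
    rw [← Module.End.mul_apply, ← map_mul, inv_mul_cancel, map_one, Module.End.one_apply]
  · -- (2) homogeneity under the split centre `e = exp(t · 1) = e^t · 1`, `σS(e⁻¹) = e^{-tw}`
    intro t Yt g c
    have hcoe := coe_expMem_smul_one (hcpt := hcpt) t
    have hinv : ∀ v, ConeDictionary.σS hcpt S lam ((AutomorphyDatum.gl n K hcpt).arch.expMem
        (t • (⟨1, trivial⟩ : (AutomorphyDatum.gl n K hcpt).arch.lie)))⁻¹ v = (Real.exp (-(t * w)) : ℂ) • v := by
      intro v
      rw [← RealMatrixGroup.expMem_neg, ← neg_smul, hσZ, neg_mul]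
    generalize (AutomorphyDatum.gl n K hcpt).arch.expMem
      (t • (⟨1, trivial⟩ : (AutomorphyDatum.gl n K hcpt).arch.lie)) = e at hcoe hinv ⊢
    have hem : (((g * e : (AutomorphyDatum.gl n K hcpt).arch.carrier) : GL (Fin n) (mixedSpace K)) :
          Matrix (Fin n) (Fin n) (mixedSpace K)) =
        Real.exp t • (((g : (AutomorphyDatum.gl n K hcpt).arch.carrier) : GL (Fin n) (mixedSpace K)) :
          Matrix (Fin n) (Fin n) (mixedSpace K)) := by
      rw [Subgroup.coe_mul, Units.val_mul, hcoe, Algebra.algebraMap_eq_smul_one, Matrix.mul_smul, Matrix.mul_one]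
    have hr : 0 < Real.exp t * Real.exp t := mul_pos (Real.exp_pos t) (Real.exp_pos t)
    have hsqe : sq (g * e) = (Real.exp t * Real.exp t) • sq g := Subtype.ext (by
      rw [hsq, Submodule.coe_smul, hsq, hem, Matrix.conjTranspose_smul, star_trivial, Matrix.smul_mul,
        Matrix.mul_smul, smul_smul])
    have htge : ∀ Y, tg (g * e) Y = (Real.exp t * Real.exp t) • tg g Y := fun Y => Subtype.ext (by
      rw [htg, Submodule.coe_smul, htg, hem, Matrix.conjTranspose_smul, star_trivial]
      simp only [Matrix.smul_mul, Matrix.mul_smul, smul_add, smul_smul])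
    rw [hu, hu, mul_inv_rev, map_mul, Module.End.mul_apply, hinv, hsqe]
    simp only [htge]
    rw [hβsc _ _ hr _ (hpos g)]
  · -- (3) right invariance under the level: `c v` and `c` define the same coset
    intro Yt g c v hv
    rw [hu, hu, QuotientGroup.mk_mul_of_mem c hv]
  · -- (4) a skew-hermitian argument: `tg g Y = g (Y + Yᴴ) gᴴ = 0`
    rintro Yt g c ⟨i, hi⟩
    have h0 : tg g (Yt i) = 0 := Subtype.ext (by
      rw [htg, hi, Submodule.coe_zero, Matrix.mul_neg, Matrix.neg_mul, add_neg_cancel])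
    rw [hu, (β _ (sq g)).map_coord_zero (m := fun j => tg g (Yt j)) i h0, map_zero]
  · -- (5) the centre: `tg g 1 = 2 sq g` is twice the Euler vector at `sq g`
    rintro Yt g c ⟨i, hi⟩
    have h1 : ((Yt i : (AutomorphyDatum.gl n K hcpt).arch.lie) : Matrix (Fin n) (Fin n) (mixedSpace K)) = 1 := by
      rw [hi]
    have h2 : tg g (Yt i) = (2 : ℝ) • sq g := Subtype.ext (by
      rw [htg, h1, Submodule.coe_smul, hsq, Matrix.conjTranspose_one, Matrix.mul_one, two_smul])
    have hupd : (fun j => tg g (Yt j)) = Function.update (fun j => tg g (Yt j)) i ((2 : ℝ) • sq g) := by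
      rw [← h2, Function.update_eq_self]
    rw [hu, hupd, (β _ (sq g)).map_update_smul,
      hβeu _ (sq g) (hpos g) (Function.update (fun j => tg g (Yt j)) i (sq g)) ⟨i, Function.update_self ..⟩,
      smul_zero, map_zero]

end Summit.Langlands.Langlands.Theorems.HeckeEigenvalueField.Res

end
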